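import Literature.AlgebraicGeometry.ModuliOfAbelianVarieties.SiegelRationalModelHeckeAction
import Literature.AlgebraicGeometry.ModuliOfAbelianVarieties.SiegelCanonicalReciprocityLevelChange
import HarnessLib

/-!
# The integral Hecke operators of a Siegel rational model commute with the transition maps of the `ℚ`-tower
# ([Deligne1971TravauxShimura] Déf. 3.1; [Milne2005ShimuraVarieties] Thm. 13.6)

Topic `AlgebraicGeometry/ModuliOfAbelianVarieties`; namespace `Literature.AlgebraicGeometry.ModuliOfAbelianVarieties`.
THEOREMS ONLY (no definition, no named fact, no instance, no `sorry`; net debt 0).  Cell hodgecm-mathlib, #60 road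
(A-p05 g7 table, node R60-7d «the Hecke action is an action on the `ℚ`-TOWER»; MUMFORD-LINE-SPEC §4 HECKE (M4/C4); director g6
RULING s86 (2)(b) banked generic leaf).  Sequel of ★ `SiegelRationalModelHeckeAction` (`SiegelRationalModel.exists_heckeAction`:
at each level the `Tq` of `HasIntegralHecke` assemble to `act : GSp_δ(ℤ̂) →* Aut_ℚ(Nm_K)`) and ★ R60-25
`SiegelCanonicalReciprocityLevelChange` (A-p05: `map_ptQ`, `ptsSymm_mk_eq_map`).

THE PRINT.  [Deligne1971TravauxShimura] Déf. 3.1 p. 136: a model of `M_ℂ(G, h)` over `E` is a projective SYSTEM `(_K M_E)_K` «muni de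
l'action de `G(𝔸_f)`» and an isomorphism with `M_ℂ` compatible with the action — the Hecke operators are morphisms of the SYSTEM,
i.e. they commute with the transition maps; [Milne2005ShimuraVarieties] Thm. 13.6 p. 118 (the action of `G(𝔸_f)` on the canonical
model as an inverse system).  The tree's (σ4)-D predicate ★ `SiegelRationalModel.HasIntegralHecke` only posits the operators
LEVELWISE (for `γ ∈ K_δ(1) = GSp_δ(ℤ̂)`); this file proves the compatibility with the transitions `Nm(f)`, `f : K₁ ⟶ K₂`, from it.

WHAT IS HERE.  §1 `SiegelRationalModel.hom_comp_map_eq_map_comp_of_ptQ` — two `ℚ`-endomorphisms `T₁` of `Nm_{K₁}` and `T₂` of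
`Nm_{K₂}` that act on the `ℚ`-structure points by the SAME right translate `[J, a] ↦ [J, aγ]` satisfy `T₁ ≫ Nm(f) = Nm(f) ≫ T₂`
(complex points separate `ℚ`-morphisms out of the reduced finite-type `Nm_{K₁}` into the separated `Nm_{K₂}`, ★
`SchemeOver.hom_ext_of_forall_algPoints`; every point is a `ptQ [J, a]`, ★ `exists_eq_ptQ_mk`; naturality ★ `map_ptQ`).
§2 `SiegelRationalModel.exists_heckeAction_comp_map` — under `HasIntegralHecke`, the actions `act_K : GSp_δ(ℤ̂) →* Aut_ℚ(Nm_K)` of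
★ `exists_heckeAction` at two levels `K₁ ⟶ K₂` commute with `Nm(f)`: the integral Hecke action is an action on the `ℚ`-tower.

## References
* [Deligne1971TravauxShimura] P. Deligne, *Travaux de Shimura*, Sém. Bourbaki 389 (1971): Déf. 3.1 p. 136; 4.16–4.17 p. 150.
* [Milne2005ShimuraVarieties] J. S. Milne, *Introduction to Shimura varieties* (2005): Thm. 13.6 p. 118; §13 p. 117.
* [MumfordAV1970] D. Mumford, *Abelian Varieties* (1970), §4 (points separate morphisms).
-/

set_option autoImplicit false

noncomputable section

open CategoryTheory CategoryTheory.Limits AlgebraicGeometry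
open Literature.AlgebraicGeometry.Motives Literature.AlgebraicGeometry.HodgeTheory

namespace Literature.AlgebraicGeometry.ModuliOfAbelianVarieties

namespace SiegelRationalModel

variable {g : ℕ} {δ : Fin g → ℕ} {Sg : SiegelComplexRecordSystem g δ} (R : SiegelRationalModel g δ Sg)

-- as in ★ `SiegelRationalModelHeckeAction`: the `IsIso`/`IsOpenImmersion` instance on `(R.e.hom.app K).left` needs it
set_option backward.isDefEq.respectTransparency false

/-! ### §1. Endomorphisms with the same point formula commute with the transitions -/

/-- **`ℚ`-endomorphisms acting on points by the same right translate commute with the transition maps.**  If `T₁ : Nm_{K₁} → Nm_{K₁}`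
and `T₂ : Nm_{K₂} → Nm_{K₂}` act on the `ℚ`-structure points by `[J, a] ↦ [J, aγ]` (the point formula of ★ `HasIntegralHecke`), then
for `f : K₁ ⟶ K₂` one has `T₁ ≫ Nm(f) = Nm(f) ≫ T₂` (complex points separate morphisms from the reduced finite-type `Nm_{K₁}` to the
separated `Nm_{K₂}`; on points both sides send `ptQ [J, a]` to `ptQ [J, aγ]` at level `K₂`, by ★ `map_ptQ`).
[cite: Deligne1971TravauxShimura, Déf. 3.1 p. 136] [cite: Milne2005ShimuraVarieties, Thm. 13.6 p. 118] [cite: MumfordAV1970, §4] -/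
theorem hom_comp_map_eq_map_comp_of_ptQ {K₁ K₂ : SiegelLevel δ} (f : K₁ ⟶ K₂) {γ : gspFinAdelic δ}
    {T₁ : R.Nm.obj K₁ ⟶ R.Nm.obj K₁} {T₂ : R.Nm.obj K₂ ⟶ R.Nm.obj K₂}
    (hT₁ : ∀ (J : C0pm δ) (a : gspFinAdelic δ),
      AlgPoints.map T₁ (R.ptQ K₁ ((Sg.pts K₁).symm (SiegelShimuraSet.mk δ K₁.1 J a))) =
        R.ptQ K₁ ((Sg.pts K₁).symm (SiegelShimuraSet.mk δ K₁.1 J (a * γ))))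
    (hT₂ : ∀ (J : C0pm δ) (a : gspFinAdelic δ),
      AlgPoints.map T₂ (R.ptQ K₂ ((Sg.pts K₂).symm (SiegelShimuraSet.mk δ K₂.1 J a))) =
        R.ptQ K₂ ((Sg.pts K₂).symm (SiegelShimuraSet.mk δ K₂.1 J (a * γ)))) :
    T₁ ≫ R.Nm.map f = R.Nm.map f ≫ T₂ := by
  -- complex points separate `ℚ`-morphisms `Nm_{K₁} → Nm_{K₂}`
  haveI : IsSeparated (R.Nm.obj K₂).hom := isSeparated_hom_of_isQuasiProjectiveOver (R.quasiProjective K₂)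
  haveI : LocallyOfFiniteType (R.Nm.obj K₁).hom := locallyOfFiniteType_hom_of_isQuasiProjectiveOver (R.quasiProjective K₁)
  haveI : Smooth (Sg.Mc.obj K₁).hom := Sg.smooth K₁
  haveI : IsReduced (Sg.Mc.obj K₁).left := isReduced_of_smooth_over_field (Sg.Mc.obj K₁).hom
  haveI : IsReduced ((Motives.baseChangeHom (algebraMap ℚ ℂ)).obj (R.Nm.obj K₁)).left :=
    isReduced_of_isOpenImmersion (R.e.hom.app K₁).left
  haveI : IsReduced (R.Nm.obj K₁).left := isReduced_of_baseChangeHom (algebraMap ℚ ℂ) (R.Nm.obj K₁)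
  refine SchemeOver.hom_ext_of_forall_algPoints ℂ fun P => ?_
  obtain ⟨J, a, rfl⟩ := R.exists_eq_ptQ_mk K₁ P
  change AlgPoints.map (T₁ ≫ R.Nm.map f) _ = AlgPoints.map (R.Nm.map f ≫ T₂) _
  rw [AlgPoints.map_comp_apply, AlgPoints.map_comp_apply, hT₁, R.map_ptQ f, R.map_ptQ f,
    ← ptsSymm_mk_eq_map Sg f J (a * γ), ← ptsSymm_mk_eq_map Sg f J a, hT₂]

/-! ### §2. The integral Hecke action is an action on the `ℚ`-tower -/

/-- **Under `HasIntegralHecke` the Hecke actions at two levels commute with the transition map** `Nm(f)`, `f : K₁ ⟶ K₂`: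
the actions `act_K : GSp_δ(ℤ̂) →* Aut_ℚ(Nm_K)` of ★ `SiegelRationalModel.exists_heckeAction` (point formula `[J, a] ↦ [J, aγ⁻¹]`)
satisfy `(act_{K₁} γ).hom ≫ Nm(f) = Nm(f) ≫ (act_{K₂} γ).hom` for every `γ ∈ GSp_δ(ℤ̂)` — the `G(𝔸_f)`-action of
[Deligne1971TravauxShimura] Déf. 3.1 restricted to `GSp_δ(ℤ̂)` IS an action on the projective system `(Nm_K)_K`.
[cite: Deligne1971TravauxShimura, Déf. 3.1 p. 136] [cite: Milne2005ShimuraVarieties, Thm. 13.6 p. 118] -/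
theorem exists_heckeAction_comp_map (hR : R.HasIntegralHecke) {K₁ K₂ : SiegelLevel δ} (f : K₁ ⟶ K₂) :
    ∃ (act₁ : ↥(principalLevelSubgroup δ 1) →* Aut (R.Nm.obj K₁))
      (act₂ : ↥(principalLevelSubgroup δ 1) →* Aut (R.Nm.obj K₂)),
      (∀ (γ : ↥(principalLevelSubgroup δ 1)) (J : C0pm δ) (a : gspFinAdelic δ),
          AlgPoints.map (act₁ γ).hom (R.ptQ K₁ ((Sg.pts K₁).symm (SiegelShimuraSet.mk δ K₁.1 J a))) =
            R.ptQ K₁ ((Sg.pts K₁).symm (SiegelShimuraSet.mk δ K₁.1 J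
              (a * ((γ⁻¹ : ↥(principalLevelSubgroup δ 1)) : gspFinAdelic δ))))) ∧
        (∀ (γ : ↥(principalLevelSubgroup δ 1)) (J : C0pm δ) (a : gspFinAdelic δ),
            AlgPoints.map (act₂ γ).hom (R.ptQ K₂ ((Sg.pts K₂).symm (SiegelShimuraSet.mk δ K₂.1 J a))) =
              R.ptQ K₂ ((Sg.pts K₂).symm (SiegelShimuraSet.mk δ K₂.1 J
                (a * ((γ⁻¹ : ↥(principalLevelSubgroup δ 1)) : gspFinAdelic δ))))) ∧
          ∀ γ : ↥(principalLevelSubgroup δ 1), (act₁ γ).hom ≫ R.Nm.map f = R.Nm.map f ≫ (act₂ γ).hom := by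
  obtain ⟨act₁, hact₁⟩ := R.exists_heckeAction hR K₁
  obtain ⟨act₂, hact₂⟩ := R.exists_heckeAction hR K₂
  exact ⟨act₁, act₂, hact₁, hact₂, fun γ => R.hom_comp_map_eq_map_comp_of_ptQ f (hact₁ γ) (hact₂ γ)⟩

end SiegelRationalModel

end Literature.AlgebraicGeometry.ModuliOfAbelianVarieties

end
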